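import Summits.AtomisticToContinuum.BoseEinsteinCondensation.Theorems.BECCutLineWeakDisorderLandscapeBoundSiblingDefs
import Summits.AtomisticToContinuum.BoseEinsteinCondensation.Theorems.BECCutLineWeakDisorderTwoReplicaTransienceBoundFactorisation
import Literature.MathematicalPhysics.QuantumManyBody.GroundStateFeynmanKacGaussian
import Literature.MathematicalPhysics.QuantumManyBody.GroundStateFeynmanKacSemigroup
import Literature.MathematicalPhysics.QuantumManyBody.SwapPurity
import HarnessLib

/-!
# Route `BECCutLineWeakDisorder`, crux `LandscapeBound` (stmt-AtomisticToContinuum-9087),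
# line `sibling-telescoping-chaining`: route R3 for the UV stub — objects, statements, and the
# one-step Gaussian domination (registered bookkeeping stub `stub_gaussianStep`)

Continuation of the route Defs file `BECCutLineWeakDisorderLandscapeBoundSiblingDefs.lean` for the
reshape v6 of the line (lead a1, wave 2: stub-worker route "R3"). The UV stub `UVFlatness`
(`E_m[r̄_K²] ≤ C` at the unit scale) is reduced to the block-mass comparison
`BlockMassComparison` (the new OPEN registered stub `stub_blockMassComparison`) through two
deterministic inputs, both PROVED in the line's files:

* (A) `GaussianStep` — **one-step Gaussian domination of the slice by the bath majorant**
  (`stub_gaussianStep`, proved HERE as `UVFlatnessR3.fkPartition_vecCons_le_gaussian_step`): for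
  `0 < s`, `0 ≤ t`, `Z_{s+t}(x::Y) ≤ ∫ p_s(x,z) F_{s,t}(z,Y) dz`, where `p_s = UVFlatnessR3.heat s`
  is the law of `x + √2 b_s` and `F = UVFlatnessR3.stepMajorant` evolves the bath for time `s`
  under its own killed interacting weight and re-inserts the tagged particle at `z` (semigroup
  law `fkPartition_add`, `Fin.cons` disintegration of `wienerPaths (n+1)`, the tagged factor of
  `fkWeight_vecCons_cons` DROPPED, Gaussian law of the tagged endpoint);
* (B) `SmoothingBlock` — the Schur-test smoothing–block inequality at the unit scale
  (`stub_smoothingBlock`, proved in `…SiblingR3Smoothing.lean`);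
* `stub_uvReduction : GaussianStep → SmoothingBlock → BlockMassComparison → UVFlatness`
  (proved in `…SiblingR3Reduction.lean`).

Objects: `UVFlatnessR3.heat`, `UVFlatnessR3.stepMajorant`, the block-kernel constants
`kerConst`, `kerRatio`, `kerBound`, `rowBound`, `rowBound₁`. NOTHING IS ASSERTED beyond the
proved stub.
-/

noncomputable section

open MeasureTheory ProbabilityTheory Filter Set Finset
open scoped ENNReal NNReal Topology BigOperators

namespace Summit.AtomisticToContinuum.BoseEinsteinCondensation.Cruxes.LandscapeBound.SiblingTelescopingChaining

open Literature.MathematicalPhysics.QuantumManyBody.BoseGas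
open Literature.Probability.Process (brownian measurable_brownian preWienerMeasure)
open Summit.AtomisticToContinuum.BoseEinsteinCondensation.Theses.BECCutLineWeakDisorder
open Summit.AtomisticToContinuum.BoseEinsteinCondensation.Cruxes.TwoReplicaTransienceBound.TracerDecoupling

/-! ### Objects and the one-step domination (A) -/

namespace UVFlatnessR3

variable {n : ℕ}

/-- The one-line free heat kernel
`p_s(x, z) = ∏_k gaussianPDF (x_k) (2s) (z_k) = (4πs)^{-3/2} e^{-|x-z|²/(4s)}` on `ℝ³`: the density
at `z` of the tagged world-line `x + √2 b_s` (speed-`2` Brownian motion), the `N = 1` instance of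
the tree's `∏ i, ∏ k, gaussianPDF (X i k) (2t) (Y i k)` (`GroundStateFeynmanKacGaussian.map_worldLine`). -/
def heat (s : ℝ≥0) (x z : Space) : ℝ≥0∞ := ∏ k : Fin 3, gaussianPDF (x k) (2 * s) (z k)

/-- `heat_apply` (route R3 helper). -/
theorem heat_apply (s : ℝ≥0) (x z : Space) :
    heat s x z = ∏ k : Fin 3, gaussianPDF (x k) (2 * s) (z k) :=
  rfl

/-- Translation form of the heat kernel: `p_s(x, z) = ∏_k gaussianPDF 0 (2s) (z_k - x_k)`. -/
theorem heat_eq_sub (s : ℝ≥0) (x z : Space) :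
    heat s x z = ∏ k : Fin 3, gaussianPDF 0 (2 * s) (z k - x k) := by
  unfold heat
  refine Finset.prod_congr rfl fun k _ => ?_
  simp only [gaussianPDF]
  rw [gaussianPDFReal_sub, zero_add]

/-- The heat kernel is jointly measurable. -/
theorem measurable_heat_uncurry (s : ℝ≥0) : Measurable fun p : Space × Space => heat s p.1 p.2 := by
  simp_rw [heat_eq_sub]
  refine Finset.measurable_prod _ fun k _ => ?_
  exact (measurable_gaussianPDF 0 _).comp
    (((measurable_pi_apply k).comp ((WithLp.measurable_ofLp 2 _).comp measurable_snd)).sub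
      ((measurable_pi_apply k).comp ((WithLp.measurable_ofLp 2 _).comp measurable_fst)))

/-- The heat kernel is measurable in the arrival point. -/
theorem measurable_heat (s : ℝ≥0) (x : Space) : Measurable (heat s x) := by
  change Measurable ((fun p : Space × Space => heat s p.1 p.2) ∘ Prod.mk x)
  exact (measurable_heat_uncurry s).comp measurable_prodMk_left

/-- The heat kernel is measurable in the starting point. -/
theorem measurable_heat_left (s : ℝ≥0) (z : Space) : Measurable fun x => heat s x z := by
  change Measurable ((fun p : Space × Space => heat s p.1 p.2) ∘ fun x => (x, z))
  exact (measurable_heat_uncurry s).comp measurable_prodMk_right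

/-- **The heat kernel is bounded by its peak**: `p_s(x, z) ≤ (4πs)^{-3/2}` (product form). -/
theorem heat_le_peak (s : ℝ≥0) (x z : Space) :
    heat s x z ≤ ∏ _k : Fin 3, ENNReal.ofReal (Real.sqrt (2 * Real.pi * (2 * s)))⁻¹ := by
  have h := heatKernel_le (N := 1) (fun _ => x) (fun _ => z) s
  simpa [heat, Fin.prod_univ_one] using h

/-- **The free one-line expectation as an integral against the heat kernel**: for measurable
`G : ℝ³ → [0, ∞]` and `s > 0`, `E[G(x + √2 b_s)] = ∫ p_s(x, z) G(z) dz` (the `N = 1` case of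
`lintegral_worldLine_eq`, transported along `(Fin 1 → α) ≃ α`). -/
theorem lintegral_wienerLine_eq (x : Space) {s : ℝ≥0} (hs : s ≠ 0) {G : Space → ℝ≥0∞}
    (hG : Measurable G) :
    ∫⁻ ω₀, G (x + WithLp.toLp 2 (fun k => Real.sqrt 2 * brownian s (ω₀ k))) ∂wienerLine =
      ∫⁻ z, heat s x z * G z := by
  have h1 := lintegral_worldLine_eq (N := 1) (fun _ => x) hs (F := fun Y => G (Y 0))
    (hG.comp (measurable_pi_apply 0))
  have hmp := measurePreserving_funUnique wienerLine (Fin 1)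
  have hvol := volume_preserving_funUnique (Fin 1) Space
  have hL : ∫⁻ ω₀, G (x + WithLp.toLp 2 (fun k => Real.sqrt 2 * brownian s (ω₀ k))) ∂wienerLine =
      ∫⁻ ω, G (worldLine (N := 1) (fun _ => x) ω s 0) ∂wienerPaths 1 := by
    rw [← hmp.lintegral_comp_emb (MeasurableEquiv.measurableEmbedding _)]
    rfl
  have hR : ∫⁻ z, heat s x z * G z =
      ∫⁻ Y : Config 1, (∏ i, ∏ k, gaussianPDF ((fun _ : Fin 1 => x) i k) (2 * s) (Y i k)) * G (Y 0) := by
    rw [← hvol.lintegral_comp_emb (MeasurableEquiv.measurableEmbedding _)]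
    refine lintegral_congr fun Y => ?_
    simp [heat, MeasurableEquiv.funUnique, Fin.default_eq_zero]
  rw [hL, hR, h1]

/-- The `(n+1)`-line world-line of `x :: Y` along `Fin.cons ω₀ ωb` is the tagged line consed onto the
bath world-lines. -/
theorem worldLine_vecCons_cons (x : Space) (Y : Config n) (ω₀ : Fin 3 → (ℝ≥0 → ℝ))
    (ωb : PathSpace n) (s : ℝ≥0) :
    worldLine (Matrix.vecCons x Y) (Fin.cons ω₀ ωb) s =
      Matrix.vecCons (x + WithLp.toLp 2 (fun k => Real.sqrt 2 * brownian s (ω₀ k)))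
        (worldLine Y ωb s) := by
  funext i
  refine Fin.cases ?_ (fun j => ?_) i
  · simp [worldLine]
  · simp [worldLine]

/-- **The one-step bath majorant** `F_{s,t}(z, Y) = ∫ fkWeight v L s Y ωb · Z_t(z :: B^bath_s(ωb)) dW_n(ωb)`:
the bath evolves for time `s` with its own killed, interaction-weighted law, and a fresh tagged
particle is inserted at `z` at time `s` for the remaining time `t` (`Z_t = fkPartition v L t`). -/
def stepMajorant (v : ℝ → ℝ≥0∞) (L s t : ℝ) (Y : Config n) (z : Space) : ℝ≥0∞ :=
  ∫⁻ ωb, fkWeight v L s Y ωb *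
    fkPartition v L t (Matrix.vecCons z (worldLine Y ωb s.toNNReal)) ∂wienerPaths n

/-- Joint measurability of the integrand of the step majorant in `(z, ωb)`. -/
theorem measurable_stepIntegrand {v : ℝ → ℝ≥0∞} (hv : Measurable v) (L s t : ℝ) (Y : Config n) :
    Measurable fun q : Space × PathSpace n => fkWeight v L s Y q.2 *
      fkPartition v L t (Matrix.vecCons q.1 (worldLine Y q.2 s.toNNReal)) := by
  refine ((measurable_fkWeight hv L s Y).comp measurable_snd).mul ?_
  have hZ : Measurable (fkPartition (N := n + 1) v L t) := measurable_fkSemigroup hv L t measurable_const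
  exact hZ.comp (measurable_vecCons.comp
    (measurable_fst.prodMk ((measurable_worldLine Y _).comp measurable_snd)))

/-- The step majorant is measurable in the insertion point. -/
theorem measurable_stepMajorant {v : ℝ → ℝ≥0∞} (hv : Measurable v) (L s t : ℝ) (Y : Config n) :
    Measurable (stepMajorant v L s t Y) :=
  (measurable_stepIntegrand hv L s t Y).lintegral_prod_right'

/-- The step majorant vanishes off the open box (the inserted tagged particle is killed at once). -/
theorem stepMajorant_of_notMem (v : ℝ → ℝ≥0∞) (L s : ℝ) {t : ℝ} (ht : 0 ≤ t) (Y : Config n)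
    {z : Space} (hz : z ∉ box L) : stepMajorant v L s t Y z = 0 := by
  unfold stepMajorant
  have h0 : ∀ ωb : PathSpace n,
      fkPartition v L t (Matrix.vecCons z (worldLine Y ωb s.toNNReal)) = 0 := by
    intro ωb
    refine fkSemigroup_of_notMem v ht _ fun hX => hz ?_
    simpa using hX 0
  simp [h0]

/-- **(A) One-step Gaussian domination of the tagged slice.** For measurable `v`, `s > 0`, `t ≥ 0`
and every bath configuration `Y`:
`Z_{s+t}(x :: Y) ≤ ∫ p_s(x, z) F_{s,t}(z, Y) dz`, where `Z = fkPartition v L ·`, `p_s` is the free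
one-line heat kernel (`heat`) and `F_{s,t}` the one-step bath majorant (`stepMajorant`). Proof: the
semigroup law `Z_{s+t} = e^{-sH} Z_t` (`fkPartition_add`), the disintegration
`wienerPaths (n+1) ≅ wienerLine ⊗ wienerPaths n` along `Fin.cons`
(`measurePreserving_piFinSuccAbove_wienerPaths`), the pointwise factorisation of the weight of
`x :: Y` into the bath weight times the tagged factor (`fkWeight_vecCons_cons`), DROPPING the
tagged factor (`≤ 1`: survival indicator times `e^{-(tagged–bath action)}`), Tonelli, and the
Gaussian law of the tagged endpoint `x + √2 b_s` (`lintegral_wienerLine_eq`). -/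
theorem fkPartition_vecCons_le_gaussian_step {v : ℝ → ℝ≥0∞} (hv : Measurable v) (L : ℝ) {s : ℝ}
    (hs : 0 < s) {t : ℝ} (ht : 0 ≤ t) (x : Space) (Y : Config n) :
    fkPartition v L (s + t) (Matrix.vecCons x Y) ≤
      ∫⁻ z, heat s.toNNReal x z * stepMajorant v L s t Y z := by
  have hs' : s.toNNReal ≠ 0 := by simpa [Real.toNNReal_eq_zero] using hs
  rw [fkPartition_add hv L hs.le ht]
  rw [fkSemigroup]
  set e := MeasurableEquiv.piFinSuccAbove (fun _ : Fin (n + 1) => Fin 3 → (ℝ≥0 → ℝ)) 0 with he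
  have hmp : MeasurePreserving e (wienerPaths (n + 1)) (wienerLine.prod (wienerPaths n)) :=
    TracerFactorisation.measurePreserving_piFinSuccAbove_wienerPaths n
  rw [← hmp.symm.lintegral_comp_emb e.symm.measurableEmbedding]
  -- the tagged displacement `ω₀ ↦ √2 b_s(ω₀) ∈ ℝ³` is measurable
  have hD : Measurable fun ω₀ : Fin 3 → (ℝ≥0 → ℝ) =>
      WithLp.toLp 2 (fun k : Fin 3 => Real.sqrt 2 * brownian s.toNNReal (ω₀ k)) :=
    (WithLp.measurable_toLp 2 _).comp (measurable_pi_lambda _ fun k =>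
      ((measurable_brownian _).const_mul _).comp (measurable_pi_apply k))
  have hG := measurable_stepIntegrand hv L s t Y
  have hφ : Measurable fun p : (Fin 3 → (ℝ≥0 → ℝ)) × PathSpace n =>
      (x + WithLp.toLp 2 (fun k : Fin 3 => Real.sqrt 2 * brownian s.toNNReal (p.1 k)), p.2) :=
    ((hD.comp measurable_fst).const_add x).prodMk measurable_snd
  have hint : Measurable fun p : (Fin 3 → (ℝ≥0 → ℝ)) × PathSpace n => fkWeight v L s Y p.2 *
      fkPartition v L t (Matrix.vecCons
        (x + WithLp.toLp 2 (fun k : Fin 3 => Real.sqrt 2 * brownian s.toNNReal (p.1 k)))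
        (worldLine Y p.2 s.toNNReal)) := by
    have h := hG.comp hφ
    exact h
  -- pointwise: drop the tagged factor
  have hpt : ∀ p : (Fin 3 → (ℝ≥0 → ℝ)) × PathSpace n,
      fkWeight v L s (Matrix.vecCons x Y) (e.symm p) *
          fkPartition v L t (worldLine (Matrix.vecCons x Y) (e.symm p) s.toNNReal) ≤
        fkWeight v L s Y p.2 * fkPartition v L t (Matrix.vecCons
          (x + WithLp.toLp 2 (fun k : Fin 3 => Real.sqrt 2 * brownian s.toNNReal (p.1 k)))
          (worldLine Y p.2 s.toNNReal)) := by
    intro p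
    rw [he, TracerFactorisation.piFinSuccAbove_symm_apply_eq_cons,
      TracerFactorisation.fkWeight_vecCons_cons hv, worldLine_vecCons_cons]
    refine mul_le_mul' ?_ le_rfl
    calc fkWeight v L s Y p.2 *
          ((survives (N := 1) L s (fun _ => x)).indicator (fun _ => (1 : ℝ≥0∞)) (fun _ => p.1) *
            expNeg (taggedBathAction v s x Y p.1 p.2))
        ≤ fkWeight v L s Y p.2 * (1 * 1) :=
          mul_le_mul' le_rfl (mul_le_mul' (Set.indicator_le_self' (fun _ _ => bot_le) _)
            (expNeg_le_one _))
      _ = fkWeight v L s Y p.2 := by rw [one_mul, mul_one]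
  refine (lintegral_mono hpt).trans ?_
  rw [lintegral_prod _ hint.aemeasurable]
  -- the inner integral is the step majorant at the tagged endpoint; then the Gaussian law
  have hF : Measurable (stepMajorant v L s t Y) := measurable_stepMajorant hv L s t Y
  exact (lintegral_wienerLine_eq x hs' hF).le

/-! ### Block-kernel constants (for (B)) -/

/-- The peak of the one-line heat kernel times the one-block slack:
`A(s, ℓ) = (4πs)^{-1/2} e^{ℓ²/(4s)}` (per coordinate). -/
def kerConst (s : ℝ≥0) (ℓ : ℝ) : ℝ := (Real.sqrt (2 * Real.pi * (2 * s)))⁻¹ * Real.exp (ℓ ^ 2 / (4 * s))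

/-- The per-block Gaussian decay ratio `q(s, ℓ) = e^{-ℓ²/(4s)} ∈ (0, 1)` (per coordinate). -/
def kerRatio (s : ℝ≥0) (ℓ : ℝ) : ℝ := Real.exp (-(ℓ ^ 2 / (4 * s)))

/-- `kerConst_pos` (route R3 helper). -/
theorem kerConst_pos (s : ℝ≥0) (ℓ : ℝ) (hs : s ≠ 0) : 0 < kerConst s ℓ := by
  unfold kerConst
  have : (0 : ℝ) < s := by exact_mod_cast pos_iff_ne_zero.2 hs
  positivity

/-- `kerRatio_pos` (route R3 helper). -/
theorem kerRatio_pos (s : ℝ≥0) (ℓ : ℝ) : 0 < kerRatio s ℓ := Real.exp_pos _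

/-- `kerRatio_lt_one` (route R3 helper). -/
theorem kerRatio_lt_one {s : ℝ≥0} (hs : s ≠ 0) {ℓ : ℝ} (hℓ : ℓ ≠ 0) : kerRatio s ℓ < 1 := by
  unfold kerRatio
  have hs' : (0 : ℝ) < s := by exact_mod_cast pos_iff_ne_zero.2 hs
  rw [Real.exp_lt_one_iff]
  have : 0 < ℓ ^ 2 / (4 * s) := by positivity
  linarith

/-- **The block kernel**: the sup over `x ∈ Q_i`, `z ∈ Q_{i'}` of the heat kernel is at most
`kerBound s ℓ i i' = ∏_d A(s,ℓ) q(s,ℓ)^{|i_d - i'_d|}`. -/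
def kerBound (s : ℝ≥0) (ℓ : ℝ) {K : ℕ} (i i' : Fin 3 → Fin (2 ^ K)) : ℝ≥0∞ :=
  ∏ d : Fin 3, ENNReal.ofReal (kerConst s ℓ * kerRatio s ℓ ^ Nat.dist (i d) (i' d))

/-- The block kernel is symmetric. -/
theorem kerBound_comm (s : ℝ≥0) (ℓ : ℝ) {K : ℕ} (i i' : Fin 3 → Fin (2 ^ K)) :
    kerBound s ℓ i i' = kerBound s ℓ i' i := by
  unfold kerBound
  simp_rw [Nat.dist_comm (i _ : ℕ)]

/-- The uniform row/column bound of the block kernel: `R(s, ℓ) = (A(s,ℓ) · 2/(1 - q(s,ℓ)))³`. -/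
def rowBound (s : ℝ≥0) (ℓ : ℝ) : ℝ≥0∞ :=
  (ENNReal.ofReal (kerConst s ℓ) * (2 * (1 - ENNReal.ofReal (kerRatio s ℓ))⁻¹)) ^ 3

/-- The unit-scale row bound `R₁(s) = (A(s,1) · 2/(1 - q(s,1/2)))³`, valid for all `ℓ ∈ [1/2, 1]`. -/
def rowBound₁ (s : ℝ≥0) : ℝ≥0∞ :=
  (ENNReal.ofReal (kerConst s 1) * (2 * (1 - ENNReal.ofReal (kerRatio s (1 / 2)))⁻¹)) ^ 3

end UVFlatnessR3

/-! ### Statements of the route-R3 stubs (signatures; nothing asserted) -/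

open UVFlatnessR3 in
/-- STUB `stub_gaussianStep` (PROVED below) — **(A) one-step Gaussian domination**: for measurable
`v`, `0 < s`, `0 ≤ t` and every slice `x :: Y`,
`Z_{s+t}(x::Y) ≤ ∫ heat s x z · stepMajorant v L s t Y z dz`. -/
def GaussianStep : Prop :=
  ∀ (n : ℕ) (v : ℝ → ℝ≥0∞), Measurable v → ∀ (L s : ℝ), 0 < s → ∀ t : ℝ, 0 ≤ t →
    ∀ (x : Space) (Y : Config n),
      fkPartition v L (s + t) (Matrix.vecCons x Y) ≤
        ∫⁻ z, heat s.toNNReal x z * stepMajorant v L s t Y z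

open UVFlatnessR3 in
/-- STUB `stub_smoothingBlock` (proved in `…SiblingR3Smoothing.lean`) — **(B) the smoothing–block
inequality**: for `g ≤ P_s F` on `ℝ³` with `g, F ≥ 0` measurable and vanishing off `Λ_L`, at the
dyadic level `K` (blocks of side `ℓ = L2^{-K}`),
`r̄_K(g)² ≤ (ℓ³)² R(s,ℓ)² · S_K(F)/S_K(g)` with the block-kernel row bound `R = rowBound s ℓ`
(discrete Schur test for the Gaussian kernel maximised over pairs of blocks). -/
def SmoothingBlock : Prop :=
  ∀ (L : ℝ), 0 < L → ∀ (K : ℕ) (s : ℝ≥0), s ≠ 0 → ∀ (g F : Space → ℝ≥0∞), Measurable g →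
    Measurable F → (∀ x, x ∉ box L → g x = 0) → (∀ z, z ∉ box L → F z = 0) →
    (∀ x, g x ≤ ∫⁻ z, heat s x z * F z) →
      uvParticipation g L K ^ 2 ≤
        ENNReal.ofReal ((L / 2 ^ K) ^ 3) ^ 2 * rowBound s (L / 2 ^ K) ^ 2 *
          (levelSq F L K / levelSq g L K)

/-- **THE MISSING INPUT of route R3 (step (iii)): block-mass comparison for the one-step
majorant, in slice-law mean.** For admissible `v`, `ρ < ρ₀(v)`, SOME smoothing time `s ∈ (0, 1]`
and constant `C`, eventually in `n`, uniformly in `T ≥ 1` — with `L = sideLength ρ (n+1)`,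
`K = depth L` (unit blocks `Q` of side `ℓ = L2^{-K} ∈ (1/2, 1]`), `Z_t = fkPartition v L t`
(`= e^{-tH_{n+1}}1`), the slice `g_Y(x) = Z_T(x :: Y)`, its mass `m(Y) = ∫ g_Y²`, and the one-step
bath majorant `F_Y(z) = ∫ fkWeight v L s Y ωb · Z_{T-s}(z :: B_s(ωb)) dW_n(ωb)` (inlined below;
`= UVFlatnessR3.stepMajorant v L s (T-s) Y z`: the bath evolved for time `s` under its own killed
interacting weight, the tagged particle re-inserted at `z` at time `s`):
  `∫ m(Y) · [Σ_Q (∫_Q F_Y)² / Σ_Q (∫_Q g_Y)²] dY ≤ C · ‖Z_T‖₂²`,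
i.e. `E_m[S_K(F_Y)/S_K(g_Y)] ≤ C` under the slice law `m(Y)dY/‖Z_T‖₂²`. Since `g_Y ≤ P_s F_Y`
((A)) and `S_K(P_sF) ≍ S_K(F)` (`levelSq_smooth_le`, `levelSq_le_levelSq_smooth`), and
`(P_sF_Y)(x) = E_{x::Y}[w^bath_s · Z_{T-s}(X_s)]` is `Z_T(x::Y)` with the tagged factor removed on
`[0, s]`, this says: re-inserting the TAGGED weight on `[0, s]` (Dirichlet survival of the tagged line and `e^{-∫₀ˢ Σ_j v(|B⁰-Bʲ|)}`) costs at
most a constant factor in the `ℓ²`-norm of the unit-block masses, on `m`-average — a lower bound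
on the tagged weight integrated over the starting points of a block given the bath (free blocks),
plus "crowded blocks carry little `F`-mass" (hard cores: packing; soft `v`: `ρ₀(v)` small). With
(A) `fkPartition_vecCons_le_gaussian_step` and (B) `uvParticipation_sq_le` it implies `UVFlatness`
(`uvFlatness_of_blockMassComparison`, constant `(R₁(s)² + 1)·C`). Absent from the tree: needs
no-crowding / superstability-type control of the tilted bath law `fkWeight dW_n` under `m(Y)dY`,
uniformly in `n` and `T`. -/
def BlockMassComparison : Prop :=
  ∀ v : ℝ → ℝ≥0∞, IsRepulsiveFiniteRange v → ∃ ρ₀ : ℝ, 0 < ρ₀ ∧ ∀ ρ : ℝ, 0 < ρ → ρ < ρ₀ →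
    ∃ s : ℝ, 0 < s ∧ s ≤ 1 ∧ ∃ C : ℝ, 0 < C ∧ ∀ᶠ n : ℕ in atTop, ∀ T : ℝ, 1 ≤ T →
      ∫⁻ Y : Config n,
          (∫⁻ x, fkPartition v (sideLength ρ (n + 1)) T (Matrix.vecCons x Y) ^ 2) *
            (levelSq (fun z => ∫⁻ ωb, fkWeight v (sideLength ρ (n + 1)) s Y ωb *
                fkPartition v (sideLength ρ (n + 1)) (T - s)
                  (Matrix.vecCons z (worldLine Y ωb s.toNNReal)) ∂wienerPaths n)
                (sideLength ρ (n + 1)) (depth (sideLength ρ (n + 1))) /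
              levelSq (fun x => fkPartition v (sideLength ρ (n + 1)) T (Matrix.vecCons x Y))
                (sideLength ρ (n + 1)) (depth (sideLength ρ (n + 1)))) ≤
        ENNReal.ofReal C *
          fkNormSq (N := n + 1) v (sideLength ρ (n + 1)) T (fun _ => (1 : ℝ≥0∞))

/-! ### Audit aliases (= the registered stub signatures) -/

namespace Goal

/-- Registered bookkeeping stub `stub_gaussianStep` ((A), proved in this file). -/
abbrev stub_gaussianStep : Prop := GaussianStep

/-- Registered bookkeeping stub `stub_smoothingBlock` ((B), proved in `…SiblingR3Smoothing.lean`). -/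
abbrev stub_smoothingBlock : Prop := SmoothingBlock

/-- Registered OPEN stub `stub_blockMassComparison` (the UV input after route R3). -/
abbrev stub_blockMassComparison : Prop := BlockMassComparison

/-- Registered bookkeeping stub `stub_uvReduction`: (A) ∧ (B) ∧ the comparison ⇒ the line's UV
stub `UVFlatness` (proved in `…SiblingR3Reduction.lean`). -/
abbrev stub_uvReduction : Prop :=
  stub_gaussianStep → stub_smoothingBlock → stub_blockMassComparison → stub_uvFlatness

end Goal

/-! ### The bookkeeping stub proved in this file -/

/-- PROVED bookkeeping stub `stub_gaussianStep` (= `UVFlatnessR3.fkPartition_vecCons_le_gaussian_step`). -/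
theorem stub_gaussianStep : Goal.stub_gaussianStep :=
  fun _ _ hv L _ hs _ ht x Y => UVFlatnessR3.fkPartition_vecCons_le_gaussian_step hv L hs ht x Y

end Summit.AtomisticToContinuum.BoseEinsteinCondensation.Cruxes.LandscapeBound.SiblingTelescopingChaining

end
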